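import Literature.Geometry.Symplectic.PlusOneSphereRigidity
import Literature.Geometry.Symplectic.PlusOneSpherePair
import Literature.Topology.FourManifolds.ToricBlowupProjectivePlane
import Mathlib.Geometry.Manifold.MFDeriv.Atlas
import Mathlib.Geometry.Manifold.LocalDiffeomorph
import Mathlib.LinearAlgebra.Prod
import HarnessLib

/-!
# `(ℂℙ², line)` in affine-complement form: the chart computation behind
`mcduffWendl_plusOneSphere_affinePair`

The named fact `Literature.Geometry.Symplectic.mcduffWendl_plusOneSphere_affinePair`
(`PlusOneSphereRigidity.lean`; Wendl 2018, Thm. D (2) = Thm. 6.9 (2); McDuff 1990, Thm. 1.4 with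
Cor. 1.5 (i)) phrases the printed conclusion "`(N, b(S))` is diffeomorphic to `(ℂℙ², L)`, `L` a
projective line" WITHOUT `ℂℙ²`, through the affine chart of `ℂℙ² ∖ L` and the map
`Θ_L[z] = (z₀ z̄₂, z₁ z̄₂) / (|z₀|² + |z₁|²)`; its module docstring records the derivation of that
form from print. This file PROVES that derivation over the tree's real-analytic `ℂℙ²`
(`Literature.Topology.FourManifolds.ComplexProjectivePlane`, affine charts `affineChart i`):

* `Literature.Geometry.Symplectic.PlusOneSphereRigidity.thetaL` — the map `Θ_L : ℂℙ² → ℝ⁴`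
  (the blow-down coordinates `ToricBlowup.bdC` of `ToricBlowupProjectivePlane.lean` read in
  `ℝ⁴`), with its three chart expressions: in the chart `z₂ ≠ 0` it is the inversion
  `ι w = w / ‖w‖²` (`thetaL_affine₂`), in the charts `z₀ ≠ 0`, `z₁ ≠ 0` it is
  `(a, b) ↦ b̄ · (1, a) / (1 + |a|²)` resp. `b̄ · (a, 1) / (|a|² + 1)` (`thetaL_affine₀`,
  `thetaL_affine₁`), smooth on all of `ℝ⁴`; hence `Θ_L` is smooth off `q = [0 : 0 : 1]`, vanishes
  exactly to the extent needed on `L = {z₂ = 0}`, and `dim ker dΘ_L = 2` along `L`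
  (`finrank_ker_mfderiv_thetaL`).
* `Literature.Geometry.Symplectic.PlusOneSphereRigidity.affinePair_of_pairDiffeo` — **the glue**:
  for ANY smooth 4-manifold `N`, subset `B ⊆ N` and diffeomorphism `Φ : N ≃ₘ ℂℙ²` with
  `Φ '' B = L`, the maps `Ψ := affineChart 2 ∘ Φ`, `Θ := Θ_L ∘ Φ` and the open set
  `W := Φ⁻¹(ℂℙ² ∖ {q})` satisfy the nine conjuncts of the named fact.
* `Literature.Geometry.Symplectic.mcduffWendl_plusOneSphere_affinePair_of_pairDiffeo` — hence the
  named fact FOLLOWS from the smooth content of the printed theorem in its natural form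
  ("under the hypotheses of the fact there is a diffeomorphism `N ≃ₘ ℂℙ²` carrying `b(S)` onto the
  line `{z₂ = 0}`"), and `affinePair_complexProjectivePlane` — the conclusion holds for
  `(ℂℙ², L)` itself (non-vacuity of the conclusion's shape).
* `Literature.Geometry.Symplectic.mcduffWendl_plusOneSphere_affinePair_of_pairDiffeomorph` — that
  natural form IS the tree's named fact
  `Literature.Geometry.Symplectic.mcduff_plusOneSphere_pairDiffeomorph` (`PlusOneSpherePair.lean`,
  same hypotheses, conclusion `∃ Φ : N ≃ₘ ℂℙ², Φ '' range b = {v₂ = 0}`), so the affine-complement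
  fact is a PROVED COROLLARY of the pair-form fact: the formalisation debt of both is the single
  name `mcduff_plusOneSphere_pairDiffeomorph`, recognisably the printed statement.

What is NOT here: the discharge `mcduffWendl_plusOneSphere_affinePair_holds` — it is exactly
`mcduffWendl_plusOneSphere_affinePair_of_pairDiffeomorph h` for a proof `h` of the pair-form fact,
which the tree does not have. The remaining content is exactly the printed theorem (a closed connected minimal symplectic 4-manifold with a
symplectic `(+1)`-sphere `S` is `(ℂℙ², c ω_FS)` with `S ↦ ℂℙ¹`), whose proof — moduli spaces of
embedded `J`-holomorphic spheres, Gromov compactness, positivity of intersections and the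
adjunction formula, the Lefschetz pencil of Wendl's Thm. F, the blow-down Prop. 3.27 and
Thm. 3.33 with Moser stability (Wendl 2018, proof of Thm. 6.6, PDF p. 137) — rests on
pseudo-holomorphic curve theory that neither Mathlib nor `Literature/` has (triage: SIZE XL).

## References

* C. Wendl, *Holomorphic Curves in Low Dimensions*, LNM 2216 (2018), §1.2 Thm. D, §6.2 Thm. 6.9
  [Wendl2018].
* D. McDuff, *The structure of rational and ruled symplectic 4-manifolds*, JAMS 3 (1990),
  Thm. 1.4, Cor. 1.5 (i) [McDuff1990].
* P. Griffiths, J. Harris, *Principles of Algebraic Geometry* (1978), Ch. 0 §2 (affine charts of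
  `ℙⁿ`) [GriffithsHarrisPrinciples1978].
-/

noncomputable section

open scoped Manifold ContDiff Topology ComplexConjugate
open Set Function Module Complex
open Literature.Topology.FourManifolds Literature.Topology.FourManifolds.ComplexProjectiveSpace
  Literature.Topology.FourManifolds.ToricBlowup

namespace Literature.Geometry.Symplectic

namespace PlusOneSphereRigidity

/-- Local notation for the model space `ℝ⁴ = EuclideanSpace ℝ (Fin 4)`. -/
local notation "𝔼4" => EuclideanSpace ℝ (Fin 4)

/-! ### Linear algebra: kernels under composition with isomorphisms -/

/-- Precomposing with a linear isomorphism does not change the dimension of the kernel.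
[folklore] -/
theorem finrank_ker_comp_equiv {U V W : Type*} [AddCommGroup U] [Module ℝ U] [AddCommGroup V]
    [Module ℝ V] [AddCommGroup W] [Module ℝ W] (f : V →ₗ[ℝ] W) (e : U ≃ₗ[ℝ] V) :
    finrank ℝ (LinearMap.ker (f ∘ₗ (e : U →ₗ[ℝ] V))) = finrank ℝ (LinearMap.ker f) := by
  rw [LinearMap.ker_comp, Submodule.comap_equiv_eq_map_symm]
  exact LinearEquiv.finrank_map_eq e.symm _

/-- Precomposing with a bijective linear map does not change the dimension of the kernel.
[folklore] -/
theorem finrank_ker_comp_eq_of_bijective {U V W : Type*} [AddCommGroup U] [Module ℝ U]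
    [AddCommGroup V] [Module ℝ V] [AddCommGroup W] [Module ℝ W] (f : V →ₗ[ℝ] W) {e : U →ₗ[ℝ] V}
    (he : Bijective e) :
    finrank ℝ (LinearMap.ker (f ∘ₗ e)) = finrank ℝ (LinearMap.ker f) := by
  have h : f ∘ₗ e = f ∘ₗ ((LinearEquiv.ofBijective e he : U ≃ₗ[ℝ] V) : U →ₗ[ℝ] V) := by
    ext x; rfl
  rw [h]
  exact finrank_ker_comp_equiv f _

/-- Precomposing a continuous linear map with a bijective one does not change the dimension of
the kernel (stated over bare topological modules, so that it applies verbatim to tangent spaces).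
[folklore] -/
theorem finrank_ker_comp_of_bijective {U V W : Type*} [TopologicalSpace U] [AddCommGroup U]
    [Module ℝ U] [TopologicalSpace V] [AddCommGroup V] [Module ℝ V] [TopologicalSpace W]
    [AddCommGroup W] [Module ℝ W] (f : V →L[ℝ] W) {e : U →L[ℝ] V} (he : Bijective e) :
    finrank ℝ (LinearMap.ker (f.comp e).toLinearMap) = finrank ℝ (LinearMap.ker f.toLinearMap) :=
  finrank_ker_comp_eq_of_bijective f.toLinearMap (e := e.toLinearMap) he

/-- Postcomposing a continuous linear map with an injective one does not change the kernel.
[folklore] -/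
theorem ker_comp_of_injective {U V W : Type*} [TopologicalSpace U] [AddCommGroup U]
    [Module ℝ U] [TopologicalSpace V] [AddCommGroup V] [Module ℝ V] [TopologicalSpace W]
    [AddCommGroup W] [Module ℝ W] {g : V →L[ℝ] W} (hg : Injective g) (f : U →L[ℝ] V) :
    LinearMap.ker (g.comp f).toLinearMap = LinearMap.ker f.toLinearMap :=
  LinearMap.ker_comp_of_ker_eq_bot f.toLinearMap (g := g.toLinearMap) (LinearMap.ker_eq_bot.2 hg)

/-! ### `ℝ⁴ ≅ ℂ²` as a continuous linear isomorphism -/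

/-- `ToricBlowup.toC2 : ℝ⁴ → ℂ²`, `v ↦ (v₀ + i v₂, v₁ + i v₃)`, as a continuous real-linear
isomorphism (inverse `ToricBlowup.fromC2`). [folklore] -/
def toC2L : 𝔼4 ≃L[ℝ] ℂ × ℂ :=
  LinearEquiv.toContinuousLinearEquiv
    { toFun := toC2
      invFun := fromC2
      map_add' := fun v w => by
        refine Prod.ext (Complex.ext ?_ ?_) (Complex.ext ?_ ?_) <;> simp [toC2]
      map_smul' := fun r v => by
        refine Prod.ext (Complex.ext ?_ ?_) (Complex.ext ?_ ?_) <;> simp [toC2]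
      left_inv := fromC2_toC2
      right_inv := toC2_fromC2 }

/-- `toC2L` is `toC2` as a function. [folklore] -/
@[simp] theorem toC2L_apply (v : 𝔼4) : toC2L v = toC2 v := rfl

/-- `toC2L.symm` is `fromC2` as a function. [folklore] -/
@[simp] theorem toC2L_symm_apply (p : ℂ × ℂ) : toC2L.symm p = fromC2 p := rfl

/-! ### The line at infinity and the map `Θ_L` -/

/-- The projective line at infinity `L = {[v₀ : v₁ : 0]} ⊆ ℂℙ²`, the complement of the source of
the third affine chart `affineChart 2` (Griffiths–Harris, Ch. 0 §2). [folklore] -/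
def lineAtInfinity : Set ComplexProjectivePlane := {y | ¬ CoordNeZero (n := 2) 2 y}

/-- `[v] ∈ L ↔ v₂ = 0`. [folklore] -/
theorem pt_mem_lineAtInfinity_iff (v : Fin 3 → ℂ) (hv : v ≠ 0) :
    pt v hv ∈ lineAtInfinity ↔ v 2 = 0 := by
  simp [lineAtInfinity, pt]

/-- The point `q = [0 : 0 : 1]` is not on the line at infinity. [folklore] -/
theorem qPt_not_mem_lineAtInfinity : qPt ∉ lineAtInfinity := by
  rw [qPt, pt_mem_lineAtInfinity_iff]
  simp

/-- A point of the line at infinity is not `q`. [folklore] -/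
theorem ne_qPt_of_mem_lineAtInfinity {y : ComplexProjectivePlane} (hy : y ∈ lineAtInfinity) :
    y ≠ qPt := fun h => qPt_not_mem_lineAtInfinity (h ▸ hy)

/-- **The map `Θ_L : ℂℙ² → ℝ⁴`**, `[v] ↦ v̄₂ (v₀, v₁) / (|v₀|² + |v₁|²)` read in `ℝ⁴` (the
blow-down coordinates `ToricBlowup.bdC`, homogeneous of degree `0`; junk `0` at `q = [0 : 0 : 1]`).
On the affine part `z₂ ≠ 0` it is the inversion `w ↦ w / ‖w‖²` of the affine coordinate
(`thetaL_affine₂`); it extends smoothly across the line at infinity, where it vanishes.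
[folklore] -/
def thetaL : ComplexProjectivePlane → 𝔼4 :=
  Projectivization.lift (fun v => fromC2 (bdC (v : Fin 3 → ℂ))) (by
    rintro a b t h
    have ht : t ≠ 0 := by rintro rfl; exact a.2 (by simpa using h)
    change fromC2 (bdC (a : Fin 3 → ℂ)) = fromC2 (bdC (b : Fin 3 → ℂ))
    rw [h, bdC_smul ht])

/-- `Θ_L [v] = fromC2 (bdC v)`. [folklore] -/
@[simp] theorem thetaL_pt (v : Fin 3 → ℂ) (hv : v ≠ 0) : thetaL (pt v hv) = fromC2 (bdC v) := rfl

/-- `Θ_L` vanishes on the line at infinity. [folklore] -/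
theorem thetaL_eq_zero_of_mem {y : ComplexProjectivePlane} (hy : y ∈ lineAtInfinity) :
    thetaL y = 0 := by
  induction y using ComplexProjectiveSpace.ind with
  | h v =>
    rw [mk_eq_pt] at hy ⊢
    have h2 : (v : Fin 3 → ℂ) 2 = 0 := (pt_mem_lineAtInfinity_iff _ _).1 hy
    have hb : bdC (v : Fin 3 → ℂ) = 0 := Prod.ext (by simp [bdC, h2]) (by simp [bdC, h2])
    rw [thetaL_pt, hb, fromC2_zero]

/-- The chart expression of `Θ_L` near the line at infinity: `(a, b) ↦ b̄ • F a` for a smooth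
nowhere-vanishing `F : ℂ → ℂ²`. [folklore] -/
def chartExpr (F : ℂ → ℂ × ℂ) (p : ℂ × ℂ) : ℂ × ℂ := conj p.2 • F p.1

/-- `F₀ a = (1, a) / (1 + |a|²)` (chart `z₀ ≠ 0`). [folklore] -/
def effZero (a : ℂ) : ℂ × ℂ :=
  ((((1 + normSq a : ℝ) : ℂ))⁻¹, a * (((1 + normSq a : ℝ) : ℂ))⁻¹)

/-- `F₁ a = (a, 1) / (|a|² + 1)` (chart `z₁ ≠ 0`). [folklore] -/
def effOne (a : ℂ) : ℂ × ℂ :=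
  (a * (((normSq a + 1 : ℝ) : ℂ))⁻¹, (((normSq a + 1 : ℝ) : ℂ))⁻¹)

/-- `1 + |a|² ≠ 0` in `ℂ`. [folklore] -/
theorem one_add_normSq_ne_zero (a : ℂ) : (((1 + normSq a : ℝ) : ℂ)) ≠ 0 :=
  ofReal_ne_zero.2 (add_pos_of_pos_of_nonneg one_pos (normSq_nonneg _)).ne'

/-- `|a|² + 1 ≠ 0` in `ℂ`. [folklore] -/
theorem normSq_add_one_ne_zero (a : ℂ) : (((normSq a + 1 : ℝ) : ℂ)) ≠ 0 :=
  ofReal_ne_zero.2 (add_pos_of_nonneg_of_pos (normSq_nonneg _) one_pos).ne'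

/-- `F₀ a ≠ 0`. [folklore] -/
theorem effZero_ne_zero (a : ℂ) : effZero a ≠ 0 := fun h =>
  inv_ne_zero (one_add_normSq_ne_zero a) (congrArg Prod.fst h)

/-- `F₁ a ≠ 0`. [folklore] -/
theorem effOne_ne_zero (a : ℂ) : effOne a ≠ 0 := fun h =>
  inv_ne_zero (normSq_add_one_ne_zero a) (congrArg Prod.snd h)

/-- `F₀` is smooth. [folklore] -/
theorem contDiff_effZero : ContDiff ℝ ∞ effZero := by
  have hn : ContDiff ℝ ∞ fun a : ℂ => (((1 + normSq a : ℝ) : ℂ)) :=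
    ofRealCLM.contDiff.comp (contDiff_const.add SphereCoord.contDiff_normSq)
  exact (hn.inv one_add_normSq_ne_zero).prodMk (contDiff_id.mul (hn.inv one_add_normSq_ne_zero))

/-- `F₁` is smooth. [folklore] -/
theorem contDiff_effOne : ContDiff ℝ ∞ effOne := by
  have hn : ContDiff ℝ ∞ fun a : ℂ => (((normSq a + 1 : ℝ) : ℂ)) :=
    ofRealCLM.contDiff.comp (SphereCoord.contDiff_normSq.add contDiff_const)
  exact (contDiff_id.mul (hn.inv normSq_add_one_ne_zero)).prodMk (hn.inv normSq_add_one_ne_zero)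

/-- The chart expression `p ↦ p̄₂ • F p₁` is smooth when `F` is. [folklore] -/
theorem contDiff_chartExpr {F : ℂ → ℂ × ℂ} (hF : ContDiff ℝ ∞ F) :
    ContDiff ℝ ∞ (chartExpr F) :=
  (conjCLE.contDiff.comp contDiff_snd).smul (hF.comp contDiff_fst)

/-- **`Θ_L` in the affine chart `0`**: `[1 : a : b] ↦ b̄ (1, a) / (1 + |a|²)`. [folklore] -/
theorem thetaL_affine₀ (w : 𝔼4) :
    thetaL ((affineChart (n := 2) 0).symm w) = fromC2 (chartExpr effZero (toC2 w)) := by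
  rw [affineChart_zero_symm, thetaL_pt]
  congr 1
  refine Prod.ext ?_ ?_ <;> simp [bdC, chartExpr, effZero]; ring

/-- **`Θ_L` in the affine chart `1`**: `[a : 1 : b] ↦ b̄ (a, 1) / (|a|² + 1)`. [folklore] -/
theorem thetaL_affine₁ (w : 𝔼4) :
    thetaL ((affineChart (n := 2) 1).symm w) = fromC2 (chartExpr effOne (toC2 w)) := by
  rw [affineChart_one_symm, thetaL_pt]
  congr 1
  refine Prod.ext ?_ ?_ <;> simp [bdC, chartExpr, effOne]; ring

/-- **`Θ_L` in the affine chart `2`** is the inversion in the unit sphere of `ℝ⁴`,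
`[u : w' : 1] ↦ (u, w') / (|u|² + |w'|²)`, i.e. `w ↦ w / ‖w‖²` (also at the junk point `w = 0`).
[folklore] -/
theorem thetaL_affine₂ (w : 𝔼4) :
    thetaL ((affineChart (n := 2) 2).symm w) = sphereInversion w := by
  rw [affineChart_two_symm, thetaL_pt, sphereInversion]
  apply toC2_injective
  rw [toC2_fromC2, toC2_smul, norm_sq_eq_normSq]
  refine Prod.ext ?_ ?_ <;> simp [bdC] <;> ring

/-- On the affine part `z₂ ≠ 0`, `Θ_L` is the inversion of the affine coordinate:
`Θ_L = ι ∘ affineChart 2`. [folklore] -/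
theorem thetaL_eq_sphereInversion {y : ComplexProjectivePlane} (hy : CoordNeZero (n := 2) 2 y) :
    thetaL y = sphereInversion ((affineChart (n := 2) 2) y) := by
  conv_lhs => rw [← (affineChart (n := 2) 2).left_inv hy]
  exact thetaL_affine₂ _

/-- Off `q`, a point outside the chart `z₀ ≠ 0` lies in the chart `z₁ ≠ 0`. [folklore] -/
theorem coordNeZero_one_of_ne_qPt {y : ComplexProjectivePlane} (hy : y ≠ qPt)
    (h0 : ¬ CoordNeZero (n := 2) 0 y) : CoordNeZero (n := 2) 1 y := by
  induction y using ComplexProjectiveSpace.ind with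
  | h v =>
    rw [mk_eq_pt] at hy
    by_contra h1
    exact hy ((pt_eq_qPt_iff _).2 ⟨not_not.1 h0, not_not.1 h1⟩)

/-! ### Smoothness of `Θ_L` off `q` -/

/-- The chart-`0` expression of `Θ_L` is smooth on all of `ℝ⁴`. [folklore] -/
theorem contDiff_thetaL_chart₀ :
    ContDiff ℝ ∞ fun w : 𝔼4 => fromC2 (chartExpr effZero (toC2 w)) :=
  contDiff_fromC2.comp ((contDiff_chartExpr contDiff_effZero).comp contDiff_toC2)

/-- The chart-`1` expression of `Θ_L` is smooth on all of `ℝ⁴`. [folklore] -/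
theorem contDiff_thetaL_chart₁ :
    ContDiff ℝ ∞ fun w : 𝔼4 => fromC2 (chartExpr effOne (toC2 w)) :=
  contDiff_fromC2.comp ((contDiff_chartExpr contDiff_effOne).comp contDiff_toC2)

/-- Near a point of the chart `z₀ ≠ 0`, `Θ_L` is its chart-`0` expression composed with the chart.
[folklore] -/
theorem thetaL_eventuallyEq_chart₀ {y : ComplexProjectivePlane} (hy : CoordNeZero (n := 2) 0 y) :
    thetaL =ᶠ[𝓝 y] (fun w : 𝔼4 => fromC2 (chartExpr effZero (toC2 w))) ∘
      (affineChart (n := 2) 0 : OpenPartialHomeomorph ComplexProjectivePlane 𝔼4) := by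
  set e := (affineChart (n := 2) 0 : OpenPartialHomeomorph ComplexProjectivePlane 𝔼4)
  filter_upwards [e.open_source.mem_nhds hy] with y' hy'
  simp only [comp_apply]
  conv_lhs => rw [← e.left_inv hy']
  exact thetaL_affine₀ _

/-- Near a point of the chart `z₁ ≠ 0`, `Θ_L` is its chart-`1` expression composed with the chart.
[folklore] -/
theorem thetaL_eventuallyEq_chart₁ {y : ComplexProjectivePlane} (hy : CoordNeZero (n := 2) 1 y) :
    thetaL =ᶠ[𝓝 y] (fun w : 𝔼4 => fromC2 (chartExpr effOne (toC2 w))) ∘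
      (affineChart (n := 2) 1 : OpenPartialHomeomorph ComplexProjectivePlane 𝔼4) := by
  set e := (affineChart (n := 2) 1 : OpenPartialHomeomorph ComplexProjectivePlane 𝔼4)
  filter_upwards [e.open_source.mem_nhds hy] with y' hy'
  simp only [comp_apply]
  conv_lhs => rw [← e.left_inv hy']
  exact thetaL_affine₁ _

/-- **`Θ_L` is smooth on `ℂℙ² ∖ {q}`** (in particular across the line at infinity). [folklore] -/
theorem contMDiffAt_thetaL {y : ComplexProjectivePlane} (hy : y ≠ qPt) :
    ContMDiffAt (𝓡 4) 𝓘(ℝ, 𝔼4) ∞ thetaL y := by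
  by_cases h0 : CoordNeZero (n := 2) 0 y
  · exact (contDiff_thetaL_chart₀.contMDiff.contMDiffAt.comp y
      (contMDiffAt_affineChart h0)).congr_of_eventuallyEq (thetaL_eventuallyEq_chart₀ h0)
  · have h1 : CoordNeZero (n := 2) 1 y := coordNeZero_one_of_ne_qPt hy h0
    exact (contDiff_thetaL_chart₁.contMDiff.contMDiffAt.comp y
      (contMDiffAt_affineChart h1)).congr_of_eventuallyEq (thetaL_eventuallyEq_chart₁ h1)

/-- `Θ_L` is smooth on `ℂℙ² ∖ {q}`. [folklore] -/
theorem contMDiffOn_thetaL : ContMDiffOn (𝓡 4) 𝓘(ℝ, 𝔼4) ∞ thetaL {y | y ≠ qPt} :=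
  fun _ hy => (contMDiffAt_thetaL hy).contMDiffWithinAt

/-! ### The differential of `Θ_L` along the line at infinity has `2`-dimensional kernel -/

/-- The derivative of the chart expression `p ↦ p̄₂ • F p₁` at a point with `p₂ = 0` is
`δp ↦ δp̄₂ • F p₁`. [folklore] -/
theorem hasFDerivAt_chartExpr {F : ℂ → ℂ × ℂ} (hF : ContDiff ℝ ∞ F) {p : ℂ × ℂ}
    (hp : p.2 = 0) :
    HasFDerivAt (chartExpr F)
      ((((conjCLE : ℂ ≃L[ℝ] ℂ) : ℂ →L[ℝ] ℂ).comp (ContinuousLinearMap.snd ℝ ℂ ℂ)).smulRight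
        (F p.1)) p := by
  have hc : HasFDerivAt (fun q : ℂ × ℂ => conj q.2)
      (((conjCLE : ℂ ≃L[ℝ] ℂ) : ℂ →L[ℝ] ℂ).comp (ContinuousLinearMap.snd ℝ ℂ ℂ)) p :=
    (conjCLE : ℂ ≃L[ℝ] ℂ).hasFDerivAt.comp p hasFDerivAt_snd
  have hf : HasFDerivAt (fun q : ℂ × ℂ => F q.1)
      ((fderiv ℝ F p.1).comp (ContinuousLinearMap.fst ℝ ℂ ℂ)) p :=
    ((hF.differentiable (by simp)) p.1).hasFDerivAt.comp p hasFDerivAt_fst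
  have h := hc.smul hf
  rw [hp, map_zero, zero_smul, zero_add] at h
  exact h

/-- The kernel of `δp ↦ δp̄₂ • z` (`z ≠ 0`) is `{δp₂ = 0}`. [folklore] -/
theorem ker_smulRight_conj_snd {z : ℂ × ℂ} (hz : z ≠ 0) :
    LinearMap.ker ((((conjCLE : ℂ ≃L[ℝ] ℂ) : ℂ →L[ℝ] ℂ).comp
      (ContinuousLinearMap.snd ℝ ℂ ℂ)).smulRight z).toLinearMap =
      LinearMap.ker (LinearMap.snd ℝ ℂ ℂ) := by
  ext q
  simp [smul_eq_zero, hz]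

/-- `{δp₂ = 0} ⊆ ℂ²` has real dimension `2`. [folklore] -/
theorem finrank_ker_snd : finrank ℝ (LinearMap.ker (LinearMap.snd ℝ ℂ ℂ)) = 2 := by
  rw [LinearMap.ker_snd, LinearMap.finrank_range_of_inj LinearMap.inl_injective,
    Complex.finrank_real_complex]

/-- Kernel computation in a chart: if near `y ∈ L` the map `Θ_L` reads `p ↦ p̄₂ • F p₁` in the
affine chart `i` (`F` smooth and nowhere zero), then `dim ker d(Θ_L)_y = 2`. The chart point lies
over `p₂ = 0` because `Θ_L y = 0`; the derivative there is `δp ↦ δp̄₂ • F p₁`, with kernel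
`{δp₂ = 0}`, transported by the linear isomorphisms `ℝ⁴ ≅ ℂ²` and `d(affineChart i)_y`.
[folklore] -/
theorem finrank_ker_mfderiv_thetaL_of_chart {F : ℂ → ℂ × ℂ} (hF : ContDiff ℝ ∞ F)
    (hF0 : ∀ a, F a ≠ 0) {i : Fin 3} {y : ComplexProjectivePlane} (hy : y ∈ lineAtInfinity)
    (hi : CoordNeZero (n := 2) i y)
    (hev : thetaL =ᶠ[𝓝 y] (fun w : 𝔼4 => fromC2 (chartExpr F (toC2 w))) ∘
      (affineChart (n := 2) i : OpenPartialHomeomorph ComplexProjectivePlane 𝔼4)) :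
    finrank ℝ (LinearMap.ker (mfderiv (𝓡 4) 𝓘(ℝ, 𝔼4) thetaL y).toLinearMap) = 2 := by
  set e := (affineChart (n := 2) i : OpenPartialHomeomorph ComplexProjectivePlane 𝔼4) with he_def
  have hatlas : e ∈ atlas 𝔼4 ComplexProjectivePlane := ⟨i, rfl⟩
  have hmd := mdifferentiable_of_mem_atlas (I := 𝓡 4) hatlas
  have hD : HasMFDerivAt (𝓡 4) (𝓡 4) e y (mfderiv (𝓡 4) (𝓡 4) e y) :=
    (hmd.mdifferentiableAt hi).hasMFDerivAt
  have hbij : Bijective (mfderiv (𝓡 4) (𝓡 4) e y) := hmd.mfderiv_bijective hi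
  -- the chart point lies over `p₂ = 0`
  set p : ℂ × ℂ := toC2 (e y) with hp_def
  have hpt : thetaL y = fromC2 (chartExpr F p) := hev.eq_of_nhds
  have hzero : chartExpr F p = 0 := by
    rw [thetaL_eq_zero_of_mem hy, eq_comm, fromC2_eq_zero_iff] at hpt
    exact hpt
  have hp2 : p.2 = 0 := by
    have h := hzero
    simp only [chartExpr, smul_eq_zero, hF0, or_false, map_eq_zero] at h
    exact h
  -- the derivative of the chart expression, transported to `ℝ⁴`
  set D : ℂ × ℂ →L[ℝ] ℂ × ℂ :=
    (((conjCLE : ℂ ≃L[ℝ] ℂ) : ℂ →L[ℝ] ℂ).comp (ContinuousLinearMap.snd ℝ ℂ ℂ)).smulRight (F p.1)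
    with hD_def
  have hH : HasFDerivAt (chartExpr F) D ((toC2L : 𝔼4 ≃L[ℝ] ℂ × ℂ) (e y)) :=
    hasFDerivAt_chartExpr hF hp2
  have hg' : HasFDerivAt
      ((toC2L.symm : (ℂ × ℂ) ≃L[ℝ] 𝔼4) ∘ (chartExpr F ∘ (toC2L : 𝔼4 ≃L[ℝ] ℂ × ℂ)))
      (((toC2L.symm : (ℂ × ℂ) ≃L[ℝ] 𝔼4) : (ℂ × ℂ) →L[ℝ] 𝔼4).comp
        (D.comp ((toC2L : 𝔼4 ≃L[ℝ] ℂ × ℂ) : 𝔼4 →L[ℝ] ℂ × ℂ))) (e y) :=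
    (toC2L.symm : (ℂ × ℂ) ≃L[ℝ] 𝔼4).hasFDerivAt.comp (e y)
      (hH.comp (e y) (toC2L : 𝔼4 ≃L[ℝ] ℂ × ℂ).hasFDerivAt)
  have hg : HasFDerivAt (fun w : 𝔼4 => fromC2 (chartExpr F (toC2 w)))
      (((toC2L.symm : (ℂ × ℂ) ≃L[ℝ] 𝔼4) : (ℂ × ℂ) →L[ℝ] 𝔼4).comp
        (D.comp ((toC2L : 𝔼4 ≃L[ℝ] ℂ × ℂ) : 𝔼4 →L[ℝ] ℂ × ℂ))) (e y) :=
    hg'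
  have hθ : HasMFDerivAt (𝓡 4) 𝓘(ℝ, 𝔼4) thetaL y
      ((((toC2L.symm : (ℂ × ℂ) ≃L[ℝ] 𝔼4) : (ℂ × ℂ) →L[ℝ] 𝔼4).comp
        (D.comp ((toC2L : 𝔼4 ≃L[ℝ] ℂ × ℂ) : 𝔼4 →L[ℝ] ℂ × ℂ))).comp
          (mfderiv (𝓡 4) (𝓡 4) e y)) :=
    (hg.hasMFDerivAt.comp y hD).congr_of_eventuallyEq hev
  rw [hθ.mfderiv]
  refine (finrank_ker_comp_of_bijective _ hbij).trans ?_
  -- restate the goal over the honest types `ℝ⁴`, `ℂ²` (the tangent spaces are these by definition)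
  show finrank ℝ (LinearMap.ker (ContinuousLinearMap.toLinearMap
    ((((toC2L.symm : (ℂ × ℂ) ≃L[ℝ] 𝔼4) : (ℂ × ℂ) →L[ℝ] 𝔼4).comp
      (D.comp ((toC2L : 𝔼4 ≃L[ℝ] ℂ × ℂ) : 𝔼4 →L[ℝ] ℂ × ℂ)))))) = 2
  rw [ker_comp_of_injective (g := ((toC2L.symm : (ℂ × ℂ) ≃L[ℝ] 𝔼4) : (ℂ × ℂ) →L[ℝ] 𝔼4))
    (toC2L.symm : (ℂ × ℂ) ≃L[ℝ] 𝔼4).injective]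
  refine (finrank_ker_comp_of_bijective D (e := ((toC2L : 𝔼4 ≃L[ℝ] ℂ × ℂ) : 𝔼4 →L[ℝ] ℂ × ℂ))
    (toC2L : 𝔼4 ≃L[ℝ] ℂ × ℂ).bijective).trans ?_
  rw [hD_def, ker_smulRight_conj_snd (hF0 _), finrank_ker_snd]

/-- **Along the line at infinity the differential of `Θ_L` has `2`-dimensional kernel** (namely
`T L`): `dim ker d(Θ_L)_y = 2` for `y ∈ L`. [folklore] -/
theorem finrank_ker_mfderiv_thetaL {y : ComplexProjectivePlane} (hy : y ∈ lineAtInfinity) :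
    finrank ℝ (LinearMap.ker (mfderiv (𝓡 4) 𝓘(ℝ, 𝔼4) thetaL y).toLinearMap) = 2 := by
  by_cases h0 : CoordNeZero (n := 2) 0 y
  · exact finrank_ker_mfderiv_thetaL_of_chart contDiff_effZero effZero_ne_zero hy h0
      (thetaL_eventuallyEq_chart₀ h0)
  · have h1 : CoordNeZero (n := 2) 1 y :=
      coordNeZero_one_of_ne_qPt (ne_qPt_of_mem_lineAtInfinity hy) h0
    exact finrank_ker_mfderiv_thetaL_of_chart contDiff_effOne effOne_ne_zero hy h1
      (thetaL_eventuallyEq_chart₁ h1)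

/-! ### The glue: a pair diffeomorphism with `(ℂℙ², L)` gives the affine-complement form -/

variable {N : Type*} [TopologicalSpace N] [ChartedSpace (EuclideanSpace ℝ (Fin 4)) N]

/-- If `Φ '' B = L` for a bijection `Φ`, membership in `B` is read off through `Φ`. [folklore] -/
theorem mem_iff_of_image_eq {B : Set N} (Φ : N ≃ₘ⟮𝓡 4, 𝓡 4⟯ ComplexProjectivePlane)
    (hΦ : Φ '' B = lineAtInfinity) (x : N) : x ∈ B ↔ Φ x ∈ lineAtInfinity := by
  constructor
  · intro hx
    rw [← hΦ]
    exact mem_image_of_mem _ hx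
  · intro hx
    rw [← hΦ] at hx
    obtain ⟨x', hx', h⟩ := hx
    rwa [← Φ.injective h]

/-- **The glue.** Let `N` be a `C^∞` 4-manifold, `B ⊆ N`, and `Φ : N ≃ₘ ℂℙ²` a diffeomorphism
with `Φ '' B = L`, the line at infinity `{z₂ = 0}`. Put `Ψ := affineChart 2 ∘ Φ` (the affine
coordinate `[z] ↦ (z₀/z₂, z₁/z₂)` of `ℂℙ² ∖ L ≅ ℂ² = ℝ⁴`), `Θ := Θ_L ∘ Φ` and
`W := Φ⁻¹(ℂℙ² ∖ {[0 : 0 : 1]})`. Then: `Ψ` is smooth and injective on `Bᶜ` and maps it onto `ℝ⁴`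
with bijective differential; `W` is an open neighbourhood of `B` on which `Θ` is smooth;
`Θ = ι ∘ Ψ` on `W ∖ B` (`ι w = w / ‖w‖²`, `Literature.Topology.FourManifolds.sphereInversion`);
and on `B`, `Θ = 0` with `dim ker dΘ = 2`. This is the derivation recorded in the module
docstring of `PlusOneSphereRigidity.lean`, for an arbitrary pair diffeomorphic to `(ℂℙ², L)`.
[folklore] -/
theorem affinePair_of_pairDiffeo (B : Set N) (Φ : N ≃ₘ⟮𝓡 4, 𝓡 4⟯ ComplexProjectivePlane)
    (hΦ : Φ '' B = lineAtInfinity) :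
    ∃ (Ψ Θ : N → EuclideanSpace ℝ (Fin 4)) (W : Set N),
      ContMDiffOn (𝓡 4) 𝓘(ℝ, EuclideanSpace ℝ (Fin 4)) ∞ Ψ Bᶜ ∧ Set.InjOn Ψ Bᶜ ∧
      Ψ '' Bᶜ = Set.univ ∧
      (∀ x ∈ Bᶜ, Function.Bijective (mfderiv (𝓡 4) 𝓘(ℝ, EuclideanSpace ℝ (Fin 4)) Ψ x)) ∧
      IsOpen W ∧ B ⊆ W ∧ ContMDiffOn (𝓡 4) 𝓘(ℝ, EuclideanSpace ℝ (Fin 4)) ∞ Θ W ∧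
      (∀ x ∈ W \ B, Θ x = sphereInversion (Ψ x)) ∧
      (∀ x ∈ B, Θ x = 0 ∧
        Module.finrank ℝ (LinearMap.ker
          (mfderiv (𝓡 4) 𝓘(ℝ, EuclideanSpace ℝ (Fin 4)) Θ x).toLinearMap) = 2) := by
  set e := (affineChart (n := 2) 2 : OpenPartialHomeomorph ComplexProjectivePlane 𝔼4) with he_def
  have hatlas : e ∈ atlas 𝔼4 ComplexProjectivePlane := ⟨2, rfl⟩
  have hmd := mdifferentiable_of_mem_atlas (I := 𝓡 4) hatlas
  have hmem : ∀ x, x ∈ B ↔ Φ x ∈ lineAtInfinity := mem_iff_of_image_eq Φ hΦ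
  have hsrc : ∀ x, x ∉ B → Φ x ∈ e.source := by
    intro x hx
    show CoordNeZero (n := 2) 2 (Φ x)
    by_contra h
    exact hx ((hmem x).2 h)
  have hΦd : ∀ x, MDifferentiableAt (𝓡 4) (𝓡 4) Φ x := fun x => Φ.mdifferentiable (by simp) x
  have hΦb : ∀ x, Bijective (mfderiv (𝓡 4) (𝓡 4) Φ x) := fun x =>
    (Φ.mfderivToContinuousLinearEquiv (by simp) x).bijective
  refine ⟨fun x => e (Φ x), fun x => thetaL (Φ x), Φ ⁻¹' {y | y ≠ qPt}, ?_, ?_, ?_, ?_, ?_, ?_, ?_,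
    ?_, ?_⟩
  · -- `Ψ` is smooth on `Bᶜ`
    intro x hx
    exact ((contMDiffAt_affineChart (hsrc x hx)).comp x Φ.contMDiff.contMDiffAt).contMDiffWithinAt
  · -- `Ψ` is injective on `Bᶜ`
    intro x hx x' hx' h
    exact Φ.injective (e.injOn (hsrc x hx) (hsrc x' hx') h)
  · -- `Ψ` maps `Bᶜ` onto `ℝ⁴`
    refine eq_univ_of_forall fun w => ?_
    have htgt : w ∈ e.target := by simp [he_def]
    have hw : e.symm w ∈ e.source := e.map_target htgt
    refine ⟨Φ.symm (e.symm w), ?_, ?_⟩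
    · intro hB
      have h := (hmem _).1 hB
      rw [Diffeomorph.apply_symm_apply] at h
      exact h hw
    · show e (Φ (Φ.symm (e.symm w))) = w
      rw [Diffeomorph.apply_symm_apply, e.right_inv htgt]
  · -- the differential of `Ψ` is bijective on `Bᶜ`
    intro x hx
    have hed : MDifferentiableAt (𝓡 4) (𝓡 4) e (Φ x) := hmd.mdifferentiableAt (hsrc x hx)
    have hcomp := (hed.hasMFDerivAt.comp x (hΦd x).hasMFDerivAt).mfderiv
    rw [show (fun x => e (Φ x)) = e ∘ Φ from rfl, hcomp]
    show Bijective (⇑(mfderiv (𝓡 4) (𝓡 4) e (Φ x)) ∘ ⇑(mfderiv (𝓡 4) (𝓡 4) Φ x))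
    exact (hmd.mfderiv_bijective (hsrc x hx)).comp (hΦb x)
  · -- `W` is open
    exact isOpen_ne_qPt.preimage Φ.continuous
  · -- `B ⊆ W`
    intro x hx
    exact ne_qPt_of_mem_lineAtInfinity ((hmem x).1 hx)
  · -- `Θ` is smooth on `W`
    intro x hx
    exact ((contMDiffAt_thetaL hx).comp x Φ.contMDiff.contMDiffAt).contMDiffWithinAt
  · -- `Θ = ι ∘ Ψ` on `W ∖ B`
    rintro x ⟨-, hx⟩
    exact thetaL_eq_sphereInversion (hsrc x hx)
  · -- on `B`: `Θ = 0` and `dim ker dΘ = 2`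
    intro x hx
    have hL : Φ x ∈ lineAtInfinity := (hmem x).1 hx
    refine ⟨thetaL_eq_zero_of_mem hL, ?_⟩
    have hθd : MDifferentiableAt (𝓡 4) 𝓘(ℝ, 𝔼4) thetaL (Φ x) :=
      (contMDiffAt_thetaL (ne_qPt_of_mem_lineAtInfinity hL)).mdifferentiableAt (by simp)
    have hcomp := (hθd.hasMFDerivAt.comp x (hΦd x).hasMFDerivAt).mfderiv
    rw [show (fun x => thetaL (Φ x)) = thetaL ∘ Φ from rfl, hcomp]
    exact (finrank_ker_comp_of_bijective (mfderiv (𝓡 4) 𝓘(ℝ, 𝔼4) thetaL (Φ x))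
      (e := mfderiv (𝓡 4) (𝓡 4) Φ x) (hΦb x)).trans (finrank_ker_mfderiv_thetaL hL)

/-- Sanity check (non-vacuity of the conclusion's shape): `(ℂℙ², L)` itself is in
affine-complement form, with `Φ = id`. [folklore] -/
theorem affinePair_complexProjectivePlane :
    ∃ (Ψ Θ : ComplexProjectivePlane → EuclideanSpace ℝ (Fin 4)) (W : Set ComplexProjectivePlane),
      ContMDiffOn (𝓡 4) 𝓘(ℝ, EuclideanSpace ℝ (Fin 4)) ∞ Ψ lineAtInfinityᶜ ∧
      Set.InjOn Ψ lineAtInfinityᶜ ∧ Ψ '' lineAtInfinityᶜ = Set.univ ∧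
      (∀ x ∈ lineAtInfinityᶜ,
        Function.Bijective (mfderiv (𝓡 4) 𝓘(ℝ, EuclideanSpace ℝ (Fin 4)) Ψ x)) ∧
      IsOpen W ∧ lineAtInfinity ⊆ W ∧
      ContMDiffOn (𝓡 4) 𝓘(ℝ, EuclideanSpace ℝ (Fin 4)) ∞ Θ W ∧
      (∀ x ∈ W \ lineAtInfinity, Θ x = sphereInversion (Ψ x)) ∧
      (∀ x ∈ lineAtInfinity, Θ x = 0 ∧
        Module.finrank ℝ (LinearMap.ker
          (mfderiv (𝓡 4) 𝓘(ℝ, EuclideanSpace ℝ (Fin 4)) Θ x).toLinearMap) = 2) :=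
  affinePair_of_pairDiffeo lineAtInfinity (Diffeomorph.refl (𝓡 4) ComplexProjectivePlane ∞)
    (by simp)

end PlusOneSphereRigidity

open PlusOneSphereRigidity in
/-- **The named fact follows from the printed theorem in its natural (pair-diffeomorphism)
form.** If, under the hypotheses of `mcduffWendl_plusOneSphere_affinePair`, there is a
diffeomorphism `Φ : N ≃ₘ ℂℙ²` carrying `b(S)` onto the projective line `L = {z₂ = 0}` — the
smooth content of Wendl 2018, Thm. D (2) = Thm. 6.9 (2) (McDuff 1990, Thm. 1.4, Cor. 1.5 (i)):
`(N, s) ≅ (ℂℙ², c ω_FS)` with `S ↦ ℂℙ¹` — then the affine-complement conclusion holds, by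
`PlusOneSphereRigidity.affinePair_of_pairDiffeo`. The hypothesis is NOT vendored as a fact (it is
the same theorem as `mcduffWendl_plusOneSphere_affinePair`, D-0026); this theorem only isolates
what remains to be proved. [cite: Wendl2018, §1.2 Thm. D (2) = Thm. 6.9 (2), proof §6.2] -/
theorem mcduffWendl_plusOneSphere_affinePair_of_pairDiffeo
    (h : ∀ (N : Type) [TopologicalSpace N] [T2Space N] [SecondCountableTopology N]
      [CompactSpace N] [ConnectedSpace N] [ChartedSpace (EuclideanSpace ℝ (Fin 4)) N]
      [IsManifold (𝓡 4) ∞ N] (s : Literature.Geometry.Kaehler.MForm (𝓡 4) N ℝ 2) (S : Type)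
      [TopologicalSpace S] [CompactSpace S] [ConnectedSpace S]
      [ChartedSpace (EuclideanSpace ℝ (Fin 2)) S] [IsManifold (𝓡 2) ∞ S] (b : S → N),
      Literature.Geometry.Kaehler.IsSmoothForm s → Literature.Geometry.Kaehler.IsClosedForm s →
      (∀ x (v : TangentSpace (𝓡 4) x), v ≠ 0 → ∃ w, s x ![v, w] ≠ 0) →
      Manifold.IsSmoothEmbedding (𝓡 2) (𝓡 4) ∞ b →
      (∀ y (v : TangentSpace (𝓡 2) y), v ≠ 0 → ∃ w : TangentSpace (𝓡 2) y,
        s (b y) ![mfderiv (𝓡 2) (𝓡 4) b y v, mfderiv (𝓡 2) (𝓡 4) b y w] ≠ 0) →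
      Nonempty (S ≃ₘ⟮𝓡 2, 𝓡 2⟯ Metric.sphere (0 : EuclideanSpace ℝ (Fin 3)) 1) →
      Module.finrank ℤ (Literature.Topology.FourManifolds.singularHomologyZ N 2) = 1 →
      Subsingleton (Literature.Topology.FourManifolds.singularHomologyZ (↥((Set.range b)ᶜ)) 1) →
      ∃ Φ : N ≃ₘ⟮𝓡 4, 𝓡 4⟯ ComplexProjectivePlane, Φ '' Set.range b = lineAtInfinity) :
    mcduffWendl_plusOneSphere_affinePair := by
  intro N _ _ _ _ _ _ _ s S _ _ _ _ _ b hs hc hnd hb hbs hS h2 h1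
  obtain ⟨Φ, hΦ⟩ := h N s S b hs hc hnd hb hbs hS h2 h1
  exact affinePair_of_pairDiffeo (Set.range b) Φ hΦ

/-- **The affine-complement fact is a corollary of the pair-form fact.** The hypothesis of
`mcduffWendl_plusOneSphere_affinePair_of_pairDiffeo` is, binder for binder, the tree's named fact
`Literature.Geometry.Symplectic.mcduff_plusOneSphere_pairDiffeomorph` (`PlusOneSpherePair.lean`:
McDuff 1990, Thm. 1.4 + Cor. 1.5 (i); Wendl 2018, Thm. D (2) = Thm. 6.9 (2), smooth content, the
line being `{[v] | v₂ = 0} = PlusOneSphereRigidity.lineAtInfinity` definitionally). Hence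
`mcduff_plusOneSphere_pairDiffeomorph → mcduffWendl_plusOneSphere_affinePair`; a future discharge
`mcduff_plusOneSphere_pairDiffeomorph_holds` yields `mcduffWendl_plusOneSphere_affinePair_holds`
by this theorem. [cite: Wendl2018, §1.2 Thm. D (2) = Thm. 6.9 (2), proof §6.2] -/
theorem mcduffWendl_plusOneSphere_affinePair_of_pairDiffeomorph
    (h : mcduff_plusOneSphere_pairDiffeomorph) : mcduffWendl_plusOneSphere_affinePair :=
  mcduffWendl_plusOneSphere_affinePair_of_pairDiffeo h

end Literature.Geometry.Symplectic

end
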